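import Summits.AtomisticToContinuum.HydrodynamicLimit.Theses.OneFlightGossipEngine
import Summits.AtomisticToContinuum.HydrodynamicLimit.Theorems.TransferActivityTails.Negative.EquilibriumReduction
import HarnessLib

/-!
# Rungs of the open leaf `HotSupplyTailsIn` of line `Sketch` (coboundary-hot-cold-split) for the crux
# `OneFlightGossipEngine.EnergyActivityTails` (stmt-AtomisticToContinuum-17703)

The line reduces the crux `EnergyActivityTails` (= `TailsOf energyOf`) to its momentum twin `CollisionActivityTails`
(crux stmt-13734) and ONE open leaf, the hot-supply tails `HotSupplyTailsIn`: uniform integrability, under the TRUE pre-shock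
law, of the window energy supply a sphere RECEIVES from partners arriving with normal speed above a cap `M` chosen inside the
crux frame (after the horizon `t`, before the level `V₀`).  This file records the cheap implications around the leaf (nothing
here asserts a Theses declaration):

* `hotSupplyOf M` — the summand; `HotSupplyTails M := TailsOf (hotSupplyOf M)` (cap outside the frame) and `HotSupplyTailsIn`
  (cap inside);
* DOMINATION: `0 ≤ hotSupplyOf M ≤ energyOf` and `hotSupplyOf` is antitone in `M`, so the crux implies `HotSupplyTails M` for every
  `M` (`hotSupplyTails_of_energyActivityTails`), `HotSupplyTails M → HotSupplyTails M'` for `M ≤ M'`, `HotSupplyTails M → HotSupplyTailsIn`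
  (`M > 0`), and the crux implies `HotSupplyTailsIn` — the leaf is WEAKER than the crux;
* EQUILIBRIUM REDUCTION (unconditional, as `TransferActivityTailsNegative.equilibriumTailsOf_of_tailsOf`): for constant profiles the
  hypotheses of the frame are dischargeable in the tree (constant hs-Euler state on `[0,1)`, the constant-state LLN
  `constantStateLLN`), so `HotSupplyTailsIn` implies its equilibrium rung `EquilibriumHotSupplyTailsIn` (canonical Gibbs law,
  window `(0, w]`, `∃ M` after the flow family) — the typed target an equilibrium counterexample to the leaf has to hit
  (`not_hotSupplyTailsIn_of_not_equilibrium`).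
-/

noncomputable section

open MeasureTheory Filter Set Topology
open scoped ENNReal InnerProductSpace

namespace Summit.AtomisticToContinuum.HydrodynamicLimit.Theorems.EnergyActivityTailsHotSupplyRungs

open Literature.MathematicalPhysics.KineticTheory Literature.Analysis.FluidPDE
open Summit.AtomisticToContinuum.HydrodynamicLimit.Theorems.TransferActivityTailsNegative
  (Flow Rec energyOf TailsOf EquilibriumTailsOf tailsOf_of_le energyOf_nonneg constantStateLLN
    equilibriumTailsOf_of_tailsOf)
open Summit.AtomisticToContinuum.HydrodynamicLimit.Theorems.DenseExcursionUntied (isHardSphereEulerSolution_const)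

/-! ## The summand and the two leaf statements -/

/-- **Hot supply at cap `M`**: the energy RECEIVED by `i` (positive part of its signed gain `(‖v⁺‖² − ‖v⁻‖²)/2`) in a
collision record `c` with `c.fst = i` whose partner arrives with normal speed `|⟪v_snd⁻, ω⟫| > M` (`ω = c.impactVec`, a unit
vector at contact); zero on every collision with a cold-normal partner (line `Sketch` of crux stmt-AtomisticToContinuum-17703 —
route-internal vocabulary, not a cited notion). -/
def hotSupplyOf (M : ℝ) (N : ℕ) (i : Fin (N + 1)) (c : Rec N) : ℝ :=
  if c.fst = i ∧ M < |⟪c.preVel.2, c.impactVec⟫_ℝ| then max ((‖c.postVel.1‖ ^ 2 - ‖c.preVel.1‖ ^ 2) / 2) 0 else 0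

/-- `HST(M)` — **hot-supply tails with the cap OUTSIDE the frame**: the crux's frame verbatim (`TailsOf`) with the summand
`hotSupplyOf M`. -/
def HotSupplyTails (M : ℝ) : Prop := TailsOf (hotSupplyOf M)

/-- `HSTin` — **hot-supply tails, cap INSIDE the frame** (the registered open leaf `stub_hotSupplyTailsIn` of line `Sketch`):
the crux's frame verbatim with the summand `hotSupplyOf M` and `∃ M > 0` inserted after `t` (before `V₀`), so that "hot" means hot
relative to THIS solution on `[0, t]`. -/
def HotSupplyTailsIn : Prop :=
  ∀ (a₀ θ₀ : T3 → ℝ) (u₀ : T3 → V3), Continuous a₀ → Continuous θ₀ → Continuous u₀ →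
    (∀ x, 0 < a₀ x) → (∀ x, 0 < θ₀ x) → ∃ σ₀ : ℝ, 0 < σ₀ ∧ ∀ σ : ℝ, 0 < σ → σ < σ₀ →
    ∀ (T : ℝ) (ρ θ : ℝ → T3 → ℝ) (u : ℝ → T3 → V3), IsHardSphereEulerSolution σ T ρ u θ →
    ∀ Φ : (N : ℕ) → Flow σ N,
    TendstoHydroFieldsAt (fun N => localGibbsLaw σ a₀ u₀ θ₀ N (Φ N)) Φ ρ u θ 0 →
    ∀ t ∈ Set.Ico 0 T, ∃ M : ℝ, 0 < M ∧ ∃ V₀ : ℝ, 0 < V₀ ∧ ∀ V : ℝ, V₀ ≤ V → ∀ ε : ℝ, 0 < ε →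
    ∃ τ₀ : ℝ, 0 < τ₀ ∧ ∀ τ : ℝ, τ₀ ≤ τ → ∃ N₀ : ℕ, ∀ N : ℕ, N₀ ≤ N → ∀ s ∈ Set.Icc 0 t,
      ∫⁻ z, ENNReal.ofReal (((N : ℝ) + 1)⁻¹ * ∑ i : Fin (N + 1),
          Set.indicator {y : ℝ | V < y} (fun y => y)
            (σ / τ * (Φ N).collisionSum (Set.Ioc s (s + τ * ((N : ℝ) + 1) ^ (-(1 / 3 : ℝ))))
              (hotSupplyOf M N i) z))
        ∂(localGibbsLaw σ a₀ u₀ θ₀ N (Φ N)) ≤ ENNReal.ofReal ε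

/-! ## Domination -/

/-- The hot supply is nonnegative. -/
theorem hotSupplyOf_nonneg (M : ℝ) (N : ℕ) (i : Fin (N + 1)) (c : Rec N) : 0 ≤ hotSupplyOf M N i c := by
  unfold hotSupplyOf; split_ifs
  · exact le_max_right _ _
  · exact le_rfl

/-- The hot supply is dominated by the energy impulse, record by record. -/
theorem hotSupplyOf_le_energyOf (M : ℝ) (N : ℕ) (i : Fin (N + 1)) (c : Rec N) :
    hotSupplyOf M N i c ≤ energyOf N i c := by
  unfold hotSupplyOf energyOf
  by_cases hi : c.fst = i
  · simp only [hi, true_and, if_true]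
    split_ifs
    · refine max_le ?_ (by positivity)
      exact div_le_div_of_nonneg_right (le_abs_self _) (by norm_num)
    · positivity
  · simp [hi]

/-- The hot supply is antitone in the cap: raising `M` drops collisions. -/
theorem hotSupplyOf_antitone {M M' : ℝ} (h : M ≤ M') (N : ℕ) (i : Fin (N + 1)) (c : Rec N) :
    hotSupplyOf M' N i c ≤ hotSupplyOf M N i c := by
  unfold hotSupplyOf
  by_cases hi : c.fst = i
  · simp only [hi, true_and]
    split_ifs with h1 h2
    · exact le_rfl
    · exact absurd (h.trans_lt h1) h2
    · exact le_max_right _ _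
    · exact le_rfl
  · simp [hi]

/-- **The crux implies `HST(M)` for every cap** (domination, landed `tailsOf_of_le`). -/
theorem hotSupplyTails_of_energyActivityTails (M : ℝ)
    (h : Summit.AtomisticToContinuum.HydrodynamicLimit.Theses.OneFlightGossipEngine.EnergyActivityTails) :
    HotSupplyTails M :=
  tailsOf_of_le (hotSupplyOf_nonneg M) (hotSupplyOf_le_energyOf M) h

/-- `HST` is monotone in the cap: `HST(M) → HST(M')` for `M ≤ M'`. -/
theorem hotSupplyTails_mono {M M' : ℝ} (hMM' : M ≤ M') (h : HotSupplyTails M) : HotSupplyTails M' :=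
  tailsOf_of_le (hotSupplyOf_nonneg M') (hotSupplyOf_antitone hMM') h

/-- One global positive cap gives the frame-internal statement: `HST(M) → HSTin` (`M > 0`). -/
theorem hotSupplyTailsIn_of_hotSupplyTails {M : ℝ} (hM : 0 < M) (h : HotSupplyTails M) : HotSupplyTailsIn := by
  intro a₀ θ₀ u₀ ha hθ hu ha0 hθ0
  obtain ⟨σ₀, hσ₀, H⟩ := h a₀ θ₀ u₀ ha hθ hu ha0 hθ0
  refine ⟨σ₀, hσ₀, fun σ hσ hσlt T ρ θ u hE Φ hlim t ht => ⟨M, hM, ?_⟩⟩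
  exact H σ hσ hσlt T ρ θ u hE Φ hlim t ht

/-- **The crux implies the leaf**: `EAT → HSTin` (so the leaf is weaker than the crux; with the line's reduction
`CAT → HSTin → EAT` it is EQUIVALENT to the crux given the momentum twin). -/
theorem hotSupplyTailsIn_of_energyActivityTails
    (h : Summit.AtomisticToContinuum.HydrodynamicLimit.Theses.OneFlightGossipEngine.EnergyActivityTails) :
    HotSupplyTailsIn :=
  hotSupplyTailsIn_of_hotSupplyTails one_pos (hotSupplyTails_of_energyActivityTails 1 h)

/-! ## The equilibrium rung of the leaf -/

/-- **The equilibrium rung of `HSTin`**: constant profiles `(a₀, u₀, θ₀)`, the canonical Gibbs law, window `(0, w]`, a cap `M`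
chosen after the flow family, the crux's integrand verbatim with the summand `hotSupplyOf M`:
`lim_τ limsup_N E_G[(N+1)⁻¹ Σ_i h_i 𝟙{h_i > V}] = 0` for all `V ≥ V₀`. -/
def EquilibriumHotSupplyTailsIn : Prop :=
  ∀ (a₀ θ₀ : ℝ) (u₀ : V3), 0 < a₀ → 0 < θ₀ → ∃ σ₀ : ℝ, 0 < σ₀ ∧ ∀ σ : ℝ, 0 < σ → σ < σ₀ →
    ∀ Φ : (N : ℕ) → Flow σ N, ∃ M : ℝ, 0 < M ∧ ∃ V₀ : ℝ, 0 < V₀ ∧ ∀ V : ℝ, V₀ ≤ V → ∀ ε : ℝ, 0 < ε →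
    ∃ τ₀ : ℝ, 0 < τ₀ ∧ ∀ τ : ℝ, τ₀ ≤ τ → ∃ N₀ : ℕ, ∀ N : ℕ, N₀ ≤ N →
      ∫⁻ z, ENNReal.ofReal (((N : ℝ) + 1)⁻¹ * ∑ i : Fin (N + 1),
          Set.indicator {y : ℝ | V < y} (fun y => y)
            (σ / τ * (Φ N).collisionSum (Set.Ioc 0 (τ * ((N : ℝ) + 1) ^ (-(1 / 3 : ℝ)))) (hotSupplyOf M N i) z))
        ∂(localGibbsLaw σ (fun _ => a₀) (fun _ => u₀) (fun _ => θ₀) N (Φ N)) ≤ ENNReal.ofReal ε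

/-- **Equilibrium reduction of the leaf (unconditional)**: `HSTin` implies its equilibrium rung (constant profiles; the constant
Euler state on `[0, 1)`, `isHardSphereEulerSolution_const`; the constant-state LLN `constantStateLLN`; `t = s = 0`). -/
theorem equilibriumHotSupplyTailsIn_of_hotSupplyTailsIn : HotSupplyTailsIn → EquilibriumHotSupplyTailsIn := by
  intro h a₀ θ₀ u₀ ha hθ
  obtain ⟨σc, hσc, hc⟩ := h (fun _ => a₀) (fun _ => θ₀) (fun _ => u₀) continuous_const
    continuous_const continuous_const (fun _ => ha) (fun _ => hθ)
  obtain ⟨σ₁, hσ₁, -, hl⟩ := constantStateLLN a₀ θ₀ u₀ ha hθ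
  refine ⟨min σc σ₁, lt_min hσc hσ₁, fun σ hσ hσlt Φ => ?_⟩
  have hσc' : σ < σc := hσlt.trans_le (min_le_left _ _)
  have hσ₁' : σ < σ₁ := hσlt.trans_le (min_le_right _ _)
  obtain ⟨r, hr, hlln⟩ := hl σ hσ hσ₁'
  obtain ⟨M, hM, V₀, hV₀, H⟩ := hc σ hσ hσc' 1 (fun _ _ => r) (fun _ _ => θ₀) (fun _ _ => u₀)
    (isHardSphereEulerSolution_const σ 1 u₀ hr hθ) Φ (hlln Φ).2 0 ⟨le_rfl, one_pos⟩
  refine ⟨M, hM, V₀, hV₀, fun V hV ε hε => ?_⟩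
  obtain ⟨τ₀, hτ₀, H⟩ := H V hV ε hε
  refine ⟨τ₀, hτ₀, fun τ hτ => ?_⟩
  obtain ⟨N₀, H⟩ := H τ hτ
  refine ⟨N₀, fun N hN => ?_⟩
  have key := H N hN 0 ⟨le_rfl, le_rfl⟩
  simpa only [zero_add] using key

/-- Contrapositive: **any counterexample to the equilibrium rung refutes the leaf** (and hence, by
`hotSupplyTailsIn_of_energyActivityTails`, the crux). -/
theorem not_hotSupplyTailsIn_of_not_equilibrium (h : ¬ EquilibriumHotSupplyTailsIn) : ¬ HotSupplyTailsIn :=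
  fun hc => h (equilibriumHotSupplyTailsIn_of_hotSupplyTailsIn hc)

/-- Contrapositive up to the crux: an equilibrium counterexample to the hot-supply rung refutes `EnergyActivityTails`. -/
theorem not_energyActivityTails_of_not_equilibriumHotSupply (h : ¬ EquilibriumHotSupplyTailsIn) :
    ¬ Summit.AtomisticToContinuum.HydrodynamicLimit.Theses.OneFlightGossipEngine.EnergyActivityTails :=
  fun hc => h (equilibriumHotSupplyTailsIn_of_hotSupplyTailsIn (hotSupplyTailsIn_of_energyActivityTails hc))

end Summit.AtomisticToContinuum.HydrodynamicLimit.Theorems.EnergyActivityTailsHotSupplyRungs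

end
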